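import Literature.NumberTheory.Automorphic.HilbertRepSliceMultiplicityOne
import HarnessLib

/-!
# Multiplicity-freeness of a slice `E L` for the complementary group, from an orthogonal
# decomposition of `L` whose slices are irreducible and pairwise inequivalent
(Gelbart, *Automorphic forms on adele groups* (1975), §10, p. 152 and Thm. 10.10, p. 158;
Jacquet–Langlands, LNM 114 (1970), §16, pp. 496–503; Dixmier, *C*-algebras* (1977), §5.4)

Topic `NumberTheory/Automorphic`; theorems only (no definition, no named fact, no instance). Part
of the inline (D-0026) decomposition of the named fact
`Literature.NumberTheory.Automorphic.multiplicity_one_quaternionUnits K D` (`JacquetLanglandsParts`,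
Gelbart Thm. 10.10), types route (`QuaternionUnitsMultiplicityOneOfTypeComparison`): there the
`GL(2)`-side input of the comparison is that Gelbart's space `M = R(e) L²₀` — the range on the cusp
forms of the projection `R(e)` attached to a type at the ramified places `S` — is
**multiplicity-free as a representation of the complementary group `G^S`**, in submodule form.
In the source this is read off the decomposition `L²₀ = ⊕ π^j` (Gelbart p. 152:
"`M = ⊕_i {⊗_{v ∈ S} u_v} ⊗ {⊗_{v ∉ S} V^i_v}` […] invariant and irreducible under the action of
`G_S`"): the slice of each cuspidal constituent is `0` or an irreducible representation of `G^S`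
(its component away from `S`), and distinct constituents have inequivalent slices (strong
multiplicity one). This file proves the abstract statement behind that reading, free of tensor
products:

* `ContRepresentation.ClosedSubrep.isTopIrreducible_toContRep_of_submodule` — irreducibility of
  `W.toContRep` from the submodule form "closed invariant subspaces of `W` are `0` or `W`".
* `ContRepresentation.exists_equivariant_isometry_onto_slice` — **Schur step**: for a unitary `τ`
  of `Γ` on `H`, a homomorphism `ι : 𝔊 → Γ`, an operator `E` commuting with the commutant of
  `τ(Γ)`, a closed invariant `W ≤ H` whose `E`-slice `{x ∈ W : E x = x}` has no closed
  `τ(ι 𝔊)`-stable subspaces other than `0` and itself, and a closed `τ(ι 𝔊)`-stable,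
  `τ(ι 𝔊)`-irreducible subspace `ρ` of `E`-fixed vectors not orthogonal to `W`: the orthogonal
  projection onto `W` restricts to a non-zero multiple of an isometry of `ρ` **onto** the slice of
  `W`, commuting with `τ(ι 𝔊)` (`IsTopIrreducible.exists_norm_map_eq_mul`).
* `ContRepresentation.submodule_eq_of_sliceDecomposition` — **the multiplicity-freeness**: let
  `L ≤ H` be closed invariant, contained in the closed span of a set `S` of pairwise orthogonal
  closed invariant `W ≤ L`; let `E` commute with the commutant of `τ(Γ)` and with `τ(ι 𝔊)`, and
  `M = {y ∈ L : E y = y}`. Assume **(irreducible slices)** for `W ∈ S` the slice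
  `{x ∈ W : E x = x}` has no closed `τ(ι 𝔊)`-stable subspace other than `0` and itself, and
  **(inequivalent slices)** `W, W' ∈ S` whose slices are related by an isometric
  `τ(ι 𝔊)`-equivariant map of the (non-zero) one onto the other coincide. Then two closed
  `τ(ι 𝔊)`-stable, `τ(ι 𝔊)`-irreducible subspaces `ρ, ρ' ≤ M`, `ρ ≠ 0`, related by an isometric
  `τ(ι 𝔊)`-equivariant map of `ρ` onto `ρ'`, **coincide** — exactly the hypothesis `hMfree` of
  `not_isOrtho_of_typeTestFamily` / `multiplicity_one_quaternionUnits_of_typeTestFamily`.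
  Proof: `ρ` projects non-trivially onto some `W₀ ∈ S` (density), hence `ρ ≅ slice W₀` (Schur
  step); it projects trivially onto every other `W ∈ S` (else `slice W₀ ≅ ρ ≅ slice W`, so
  `W₀ = W`), hence `ρ ≤ W₀` and `ρ = slice W₀`; likewise `ρ' = slice W₀'`; and `ρ ≅ ρ'` forces
  `W₀ = W₀'`.

## References

* S. Gelbart, *Automorphic forms on adele groups*, Ann. of Math. Studies 83 (1975), §10, p. 152,
  Thm. 10.10 (p. 158) [Gelbart1975].
* H. Jacquet, R. P. Langlands, *Automorphic forms on GL(2)*, LNM 114 (1970), §16, pp. 496–503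
  [JacquetLanglands1970].
* J. Dixmier, *C*-algebras* (1977), 5.4, 13.1 [Dixmier1977].
* A. Deitmar, S. Echterhoff, *Principles of harmonic analysis*, 2nd ed. (2014), Cor. 6.1.9
  [DeitmarEchterhoff2014].
-/

noncomputable section

open scoped InnerProductSpace
open Topology

namespace ContRepresentation

/-! ### Irreducibility in submodule form -/

section ExplicitIrreducible

variable {𝔊 : Type*} [Group 𝔊] {H : Type*}
  [NormedAddCommGroup H] [InnerProductSpace ℂ H] [CompleteSpace H]
  {π : ContRepresentation ℂ 𝔊 H}

omit [CompleteSpace H] in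
/-- **Irreducibility of `W.toContRep` from the submodule form**: if `W ≠ 0` and every closed
invariant subspace of `H` contained in `W` is `0` or `W`, then `W.toContRep` is topologically
irreducible (`ClosedSubrep.isTopIrreducible_toContRep_iff`). [cite: Dixmier1977, §13.1.5] -/
theorem ClosedSubrep.isTopIrreducible_toContRep_of_submodule (W : ClosedSubrep π)
    (hW0 : W.toSubmodule ≠ ⊥)
    (hirr : ∀ V : Submodule ℂ H, IsClosed (V : Set H) → V ≤ W.toSubmodule →
      (∀ g : 𝔊, ∀ x ∈ V, π g x ∈ V) → V = ⊥ ∨ V = W.toSubmodule) :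
    W.toContRep.IsTopIrreducible := by
  rw [ClosedSubrep.isTopIrreducible_toContRep_iff]
  refine ⟨fun h0 => hW0 ?_, fun W' hW' => ?_⟩
  · rw [h0, ClosedSubrep.toSubmodule_bot]
  · rcases hirr W'.toSubmodule W'.isClosed hW' (fun g x hx => W'.apply_mem g hx) with h | h
    · left
      ext v
      rw [ClosedSubrep.mem_bot, ← ClosedSubrep.mem_toSubmodule, h, Submodule.mem_bot]
    · right
      ext v
      rw [← ClosedSubrep.mem_toSubmodule, h, ClosedSubrep.mem_toSubmodule]

end ExplicitIrreducible

/-! ### The Schur step and the multiplicity-freeness of the slice -/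

section SliceDecomposition

variable {Γ : Type*} [Group Γ] {𝔊 : Type*} [Group 𝔊] {H : Type*}
  [NormedAddCommGroup H] [InnerProductSpace ℂ H] [CompleteSpace H]
  {τ : ContRepresentation ℂ Γ H}

/-- **Schur step: an irreducible subspace not orthogonal to `W` is carried by the projection
isometrically (up to a scalar) onto the slice of `W`.** Let `τ` be unitary, `ι : 𝔊 → Γ` a
homomorphism, `E` an operator commuting with the commutant of `τ(Γ)`, `W` a closed invariant
subspace whose `E`-slice `{x ∈ W : E x = x}` has no closed `τ(ι 𝔊)`-stable subspace other than
`0` and itself, and `ρ` a closed `τ(ι 𝔊)`-stable subspace of `E`-fixed vectors whose closed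
`τ(ι 𝔊)`-stable subspaces are `0` and `ρ`, containing a vector with non-zero projection onto `W`.
Then there is an isometric map of `ρ` **onto** the slice of `W` commuting with `τ(ι 𝔊)` (the
projection `P_W|_ρ` is `r` times an isometry by `IsTopIrreducible.exists_norm_map_eq_mul`,
`r > 0`, with closed `τ(ι 𝔊)`-stable non-zero range inside the slice).
[cite: DeitmarEchterhoff2014, Cor. 6.1.9; Dixmier1977, 5.4] -/
theorem exists_equivariant_isometry_onto_slice (hτ : τ.IsUnitary) (ι : 𝔊 →* Γ)
    (E : H →L[ℂ] H)
    (hET : ∀ U : H →L[ℂ] H, (∀ γ : Γ, U ∘L τ γ = τ γ ∘L U) → U ∘L E = E ∘L U)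
    (W : ClosedSubrep τ) (σ : Submodule ℂ H) (hσ : ∀ x, x ∈ σ ↔ x ∈ W ∧ E x = x)
    (hσG : ∀ g : 𝔊, ∀ x ∈ σ, τ (ι g) x ∈ σ)
    (hslice : ∀ V : Submodule ℂ H, IsClosed (V : Set H) → V ≤ σ →
      (∀ g : 𝔊, ∀ x ∈ V, τ (ι g) x ∈ V) → V = ⊥ ∨ V = σ)
    (ρ : Submodule ℂ H) (hρc : IsClosed (ρ : Set H)) (hρE : ∀ x ∈ ρ, E x = x)
    (hρG : ∀ g : 𝔊, ∀ x ∈ ρ, τ (ι g) x ∈ ρ)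
    (hirr : ∀ V : Submodule ℂ H, IsClosed (V : Set H) → V ≤ ρ →
      (∀ g : 𝔊, ∀ x ∈ V, τ (ι g) x ∈ V) → V = ⊥ ∨ V = ρ)
    (hne : ∃ x ∈ ρ, W.toSubmodule.starProjection x ≠ 0) :
    ∃ U : ρ →L[ℂ] σ, (∀ x, ‖U x‖ = ‖x‖) ∧ Function.Surjective U ∧
      ∀ (g : 𝔊) (x : ρ), (U ⟨τ (ι g) x, hρG g x x.2⟩ : H) = τ (ι g) (U x) := by
  set P : H →L[ℂ] H := W.toSubmodule.starProjection with hPdef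
  have hPτ : ∀ γ : Γ, P ∘L τ γ = τ γ ∘L P := ClosedSubrep.starProjection_comp hτ W
  have hPE : P ∘L E = E ∘L P := hET P hPτ
  have hPσ : ∀ x ∈ ρ, P x ∈ σ := by
    intro x hx
    refine (hσ _).2 ⟨W.toSubmodule.starProjection_apply_mem x, ?_⟩
    have h := DFunLike.congr_fun hPE x
    simp only [ContinuousLinearMap.coe_comp, Function.comp_apply] at h
    rw [← h, hρE x hx]
  -- the two subspaces as closed subrepresentations of `τ ∘ ι`
  have hτι : (τ.restrict ι).IsUnitary := fun g => hτ (ι g)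
  let ρc : ClosedSubrep (τ.restrict ι) :=
    { toSubmodule := ρ
      apply_mem_toSubmodule := fun g v hv => hρG g v hv
      isClosed' := hρc }
  have hσc_closed : IsClosed (σ : Set H) := by
    have : (σ : Set H) = (W : Set H) ∩ {x | E x = x} := Set.ext fun x => hσ x
    rw [this]
    exact W.isClosed.inter (isClosed_eq E.continuous continuous_id)
  let σc : ClosedSubrep (τ.restrict ι) :=
    { toSubmodule := σ
      apply_mem_toSubmodule := fun g v hv => hσG g v hv
      isClosed' := hσc_closed }
  have hρ0 : ρ ≠ ⊥ := by
    obtain ⟨x, hx, hPx⟩ := hne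
    intro h0
    rw [h0, Submodule.mem_bot] at hx
    exact hPx (by rw [hx, map_zero])
  have hρirr : ρc.toContRep.IsTopIrreducible :=
    ClosedSubrep.isTopIrreducible_toContRep_of_submodule ρc hρ0 hirr
  -- the compressed projection `T = P|_ρ : ρ → σ`
  let T : ρc.toSubmodule →L[ℂ] σc.toSubmodule :=
    (P ∘L ρ.subtypeL).codRestrict σ fun x => hPσ x x.2
  have hTapply : ∀ x : ρc.toSubmodule, (T x : H) = P x := fun x => rfl
  have hT : ∀ g : 𝔊, T ∘L ρc.toContRep g = σc.toContRep g ∘L T := by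
    intro g
    apply ContinuousLinearMap.ext
    intro x
    apply Subtype.ext
    change P (τ (ι g) (x : H)) = τ (ι g) (P x)
    have h := DFunLike.congr_fun (hPτ (ι g)) (x : H)
    simpa only [ContinuousLinearMap.coe_comp, Function.comp_apply] using h
  obtain ⟨r, hr0, hr⟩ :=
    hρirr.exists_norm_map_eq_mul (hτι.toContRep ρc) (hτι.toContRep σc) hT
  -- `r > 0`
  have hrpos : 0 < r := by
    obtain ⟨x, hx, hPx⟩ := hne
    have h1 : ‖T ⟨x, hx⟩‖ = r * ‖(⟨x, hx⟩ : ρc.toSubmodule)‖ := hr ⟨x, hx⟩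
    have h2 : ‖T ⟨x, hx⟩‖ ≠ 0 := by
      rw [← Submodule.norm_coe, hTapply]
      exact norm_ne_zero_iff.2 hPx
    rcases hr0.lt_or_eq with h | h
    · exact h
    · exfalso
      rw [← h, zero_mul] at h1
      exact h2 h1
  -- the range of `T` is closed, `τ(ι 𝔊)`-stable, non-zero, inside `σ`: it is `σ`
  let Tᵢ : ρc.toSubmodule →ₗᵢ[ℂ] H :=
    { toLinearMap := (r⁻¹ : ℂ) • (σ.subtype ∘ₗ (T : ρc.toSubmodule →ₗ[ℂ] σc.toSubmodule))
      norm_map' := fun x => by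
        change ‖(r⁻¹ : ℂ) • ((T x : σ) : H)‖ = ‖x‖
        rw [norm_smul, Submodule.norm_coe, hr x, norm_inv, Complex.norm_real,
          Real.norm_of_nonneg hr0, ← mul_assoc, inv_mul_cancel₀ hrpos.ne', one_mul] }
  have hTᵢ_apply : ∀ x : ρc.toSubmodule, Tᵢ x = (r⁻¹ : ℂ) • P x := fun x => rfl
  set V : Submodule ℂ H := LinearMap.range Tᵢ.toLinearMap with hVdef
  have hmemV : ∀ {y : H}, y ∈ V ↔ ∃ x : ρc.toSubmodule, (r⁻¹ : ℂ) • P x = y := fun {y} => by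
    rw [hVdef, LinearMap.mem_range]
    rfl
  have hVc : IsClosed (V : Set H) := by
    have : (V : Set H) = Set.range Tᵢ := by
      ext y
      rw [SetLike.mem_coe, hmemV]
      rfl
    rw [this]
    exact Tᵢ.isometry.isClosedEmbedding.isClosed_range
  have hVσ : V ≤ σ := by
    intro y hy
    obtain ⟨x, rfl⟩ := hmemV.1 hy
    exact σ.smul_mem _ (hPσ x x.2)
  have hVG : ∀ g : 𝔊, ∀ y ∈ V, τ (ι g) y ∈ V := by
    intro g y hy
    obtain ⟨x, rfl⟩ := hmemV.1 hy
    refine hmemV.2 ⟨⟨τ (ι g) x, hρG g x x.2⟩, ?_⟩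
    have h := DFunLike.congr_fun (hPτ (ι g)) (x : H)
    simp only [ContinuousLinearMap.coe_comp, Function.comp_apply] at h
    change (r⁻¹ : ℂ) • P (τ (ι g) (x : H)) = τ (ι g) ((r⁻¹ : ℂ) • P x)
    rw [h, map_smul]
  have hV0 : V ≠ ⊥ := by
    obtain ⟨x, hx, hPx⟩ := hne
    intro h0
    have h1 : (r⁻¹ : ℂ) • P x ∈ V := hmemV.2 ⟨⟨x, hx⟩, rfl⟩
    rw [h0, Submodule.mem_bot, smul_eq_zero] at h1
    rcases h1 with h1 | h1
    · exact (inv_ne_zero (Complex.ofReal_ne_zero.2 hrpos.ne')) h1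
    · exact hPx h1
  have hVeq : V = σ := (hslice V hVc hVσ hVG).resolve_left hV0
  -- the isometry `U = r⁻¹ T : ρ → σ`
  let U : ρc.toSubmodule →L[ℂ] σc.toSubmodule := (r⁻¹ : ℂ) • T
  have hUapply : ∀ x : ρc.toSubmodule, (U x : H) = (r⁻¹ : ℂ) • P x := fun x => by
    change (((r⁻¹ : ℂ) • T x : σ) : H) = _
    rw [Submodule.coe_smul, hTapply]
  refine ⟨U, fun x => ?_, fun y => ?_, fun g x => ?_⟩
  · rw [← Submodule.norm_coe, hUapply, ← hTᵢ_apply, Tᵢ.norm_map]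
  · have hy : (y : H) ∈ V := by rw [hVeq]; exact y.2
    obtain ⟨x, hx⟩ := hmemV.1 hy
    exact ⟨x, Subtype.ext (by rw [hUapply, hx])⟩
  · have h := DFunLike.congr_fun (hPτ (ι g)) (x : H)
    simp only [ContinuousLinearMap.coe_comp, Function.comp_apply] at h
    rw [hUapply, hUapply]
    change (r⁻¹ : ℂ) • P (τ (ι g) (x : H)) = τ (ι g) ((r⁻¹ : ℂ) • P x)
    rw [h, map_smul]

/-- **The slice of a decomposable representation by an operator in the bicommutant is
multiplicity-free for the complementary group, when the slices of the members of the
decomposition are irreducible and pairwise inequivalent** (the abstract content of Gelbart's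
description of `M = R(ξ_S) L²₀` as `⊕_i {⊗_{v∈S} u_v} ⊗ {⊗_{v∉S} V_v^i}`, p. 152, combined with
(strong) multiplicity one for `GL(2)`, p. 158). Setting: `τ` unitary on `H`, `ι : 𝔊 → Γ`, `E`
commuting with the commutant of `τ(Γ)` and with `τ(ι 𝔊)`; `L` closed invariant, contained in the
closed span of a set `S` of pairwise orthogonal closed invariant `W ≤ L`; `M = {y ∈ L : E y = y}`.
Hypotheses: **(irreducible slices)** for `W ∈ S` every closed `τ(ι 𝔊)`-stable subspace of the
slice `{x ∈ W : E x = x}` is `0` or the slice; **(inequivalent slices)** if `W, W' ∈ S` and the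
slice of `W` is non-zero and mapped isometrically, `τ(ι 𝔊)`-equivariantly onto the slice of `W'`,
then `W = W'`. Conclusion: closed `τ(ι 𝔊)`-stable `ρ, ρ' ≤ M` whose closed `τ(ι 𝔊)`-stable
subspaces are trivial, with `ρ ≠ 0` and an isometric `τ(ι 𝔊)`-equivariant map of `ρ` onto `ρ'`,
satisfy `ρ = ρ'`. [cite: Gelbart1975, §10, p. 152 and Thm. 10.10 (proof), p. 158;
Dixmier1977, 5.4] -/
theorem submodule_eq_of_sliceDecomposition (hτ : τ.IsUnitary) (ι : 𝔊 →* Γ)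
    (E : H →L[ℂ] H)
    (hET : ∀ U : H →L[ℂ] H, (∀ γ : Γ, U ∘L τ γ = τ γ ∘L U) → U ∘L E = E ∘L U)
    (hEι : ∀ (g : 𝔊) (y : H), E (τ (ι g) y) = τ (ι g) (E y))
    (L : ClosedSubrep τ) (S : Set (ClosedSubrep τ)) (hSL : ∀ W ∈ S, W ≤ L)
    (hSorth : S.Pairwise fun W W' => W.toSubmodule ⟂ W'.toSubmodule)
    (hSdense : L ≤ ClosedSubrep.iSupClosure S)
    (M : Submodule ℂ H) (hM : ∀ y, y ∈ M ↔ y ∈ L ∧ E y = y)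
    (hslice : ∀ W ∈ S, ∀ V : Submodule ℂ H, IsClosed (V : Set H) →
      (∀ x ∈ V, x ∈ W ∧ E x = x) → (∀ g : 𝔊, ∀ x ∈ V, τ (ι g) x ∈ V) →
      V = ⊥ ∨ ∀ x, x ∈ V ↔ x ∈ W ∧ E x = x)
    (hsep : ∀ W ∈ S, ∀ W' ∈ S, ∀ σ σ' : Submodule ℂ H,
      (∀ x, x ∈ σ ↔ x ∈ W ∧ E x = x) → (∀ x, x ∈ σ' ↔ x ∈ W' ∧ E x = x) → σ ≠ ⊥ →
      ∀ (hσG : ∀ g : 𝔊, ∀ x ∈ σ, τ (ι g) x ∈ σ),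
      (∃ U : σ →L[ℂ] σ', (∀ x, ‖U x‖ = ‖x‖) ∧ Function.Surjective U ∧
        ∀ (g : 𝔊) (x : σ), (U ⟨τ (ι g) x, hσG g x x.2⟩ : H) = τ (ι g) (U x)) → W = W')
    (ρ ρ' : Submodule ℂ H) (hρc : IsClosed (ρ : Set H)) (hρ'c : IsClosed (ρ' : Set H))
    (hρM : ρ ≤ M) (hρ'M : ρ' ≤ M)
    (hρG : ∀ g : 𝔊, ∀ x ∈ ρ, τ (ι g) x ∈ ρ) (hρ'G : ∀ g : 𝔊, ∀ x ∈ ρ', τ (ι g) x ∈ ρ')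
    (hirr : ∀ V : Submodule ℂ H, IsClosed (V : Set H) → V ≤ ρ →
      (∀ g : 𝔊, ∀ x ∈ V, τ (ι g) x ∈ V) → V = ⊥ ∨ V = ρ)
    (hirr' : ∀ V : Submodule ℂ H, IsClosed (V : Set H) → V ≤ ρ' →
      (∀ g : 𝔊, ∀ x ∈ V, τ (ι g) x ∈ V) → V = ⊥ ∨ V = ρ')
    (hρ0 : ρ ≠ ⊥)
    (hequiv : ∃ U : ρ →L[ℂ] ρ', (∀ x, ‖U x‖ = ‖x‖) ∧ Function.Surjective U ∧
      ∀ (g : 𝔊) (x : ρ), (U ⟨τ (ι g) x, hρG g x x.2⟩ : H) = τ (ι g) (U x)) :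
    ρ = ρ' := by
  classical
  -- slices
  let slice : ClosedSubrep τ → Submodule ℂ H := fun W =>
    { carrier := {x | x ∈ W ∧ E x = x}
      add_mem' := fun {a b} ha hb =>
        ⟨W.toSubmodule.add_mem ha.1 hb.1, by rw [map_add, ha.2, hb.2]⟩
      zero_mem' := ⟨W.toSubmodule.zero_mem, map_zero E⟩
      smul_mem' := fun a y hy => ⟨W.toSubmodule.smul_mem a hy.1, by rw [map_smul, hy.2]⟩ }
  have hslice_mem : ∀ (W : ClosedSubrep τ) (x : H), x ∈ slice W ↔ x ∈ W ∧ E x = x :=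
    fun _ _ => Iff.rfl
  have hslice_G : ∀ (W : ClosedSubrep τ) (g : 𝔊), ∀ x ∈ slice W, τ (ι g) x ∈ slice W :=
    fun W g x hx => ⟨W.apply_mem (ι g) hx.1, by rw [hEι, hx.2]⟩
  have hslice_irr : ∀ W ∈ S, ∀ V : Submodule ℂ H, IsClosed (V : Set H) → V ≤ slice W →
      (∀ g : 𝔊, ∀ x ∈ V, τ (ι g) x ∈ V) → V = ⊥ ∨ V = slice W := by
    intro W hW V hVc hVle hVG
    rcases hslice W hW V hVc (fun x hx => hVle hx) hVG with h | h
    · exact Or.inl h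
    · exact Or.inr (Submodule.ext fun x => (h x).trans (hslice_mem W x).symm)
  -- vectors of `L` orthogonal to every member of `S` vanish
  have hL_dec : ∀ x ∈ L, (∀ W ∈ S, W.toSubmodule.starProjection x = 0) → x = 0 := by
    intro x hxL hx
    set K : Submodule ℂ H := ⨆ W ∈ S, (W : ClosedSubrep τ).toSubmodule with hK
    have hK' : K = ⨆ W : S, (W : ClosedSubrep τ).toSubmodule := by
      rw [hK]
      exact (iSup_subtype'' S fun W : ClosedSubrep τ => W.toSubmodule).symm
    have hxK : x ∈ Kᗮ := by
      rw [hK', ← Submodule.iInf_orthogonal, Submodule.mem_iInf]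
      intro W
      exact (Submodule.starProjection_apply_eq_zero_iff _).1 (hx W W.2)
    have hxK' : x ∈ Kᗮᗮ := by
      rw [Submodule.orthogonal_orthogonal_eq_closure]
      exact hSdense hxL
    exact inner_self_eq_zero.mp (Submodule.inner_right_of_mem_orthogonal hxK hxK')
  -- Step 1: for an irreducible `ρ₀ ≤ M`, the members of `S` it projects non-trivially onto
  have step : ∀ (ρ₀ : Submodule ℂ H), IsClosed (ρ₀ : Set H) → ρ₀ ≤ M →
      ∀ (hρ₀G : ∀ g : 𝔊, ∀ x ∈ ρ₀, τ (ι g) x ∈ ρ₀),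
      (∀ V : Submodule ℂ H, IsClosed (V : Set H) → V ≤ ρ₀ →
        (∀ g : 𝔊, ∀ x ∈ V, τ (ι g) x ∈ V) → V = ⊥ ∨ V = ρ₀) → ρ₀ ≠ ⊥ →
      ∃ W₀ ∈ S, ∀ x, x ∈ ρ₀ ↔ x ∈ W₀ ∧ E x = x := by
    intro ρ₀ hρ₀c hρ₀M hρ₀G hρ₀irr hρ₀0
    have hρ₀E : ∀ x ∈ ρ₀, E x = x := fun x hx => ((hM x).1 (hρ₀M hx)).2
    have hρ₀L : ∀ x ∈ ρ₀, x ∈ L := fun x hx => ((hM x).1 (hρ₀M hx)).1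
    -- the Schur step at every `W ∈ S` with non-zero projection
    have hU : ∀ W ∈ S, (∃ x ∈ ρ₀, W.toSubmodule.starProjection x ≠ 0) →
        ∃ U : ρ₀ →L[ℂ] slice W, (∀ x, ‖U x‖ = ‖x‖) ∧ Function.Surjective U ∧
          ∀ (g : 𝔊) (x : ρ₀), (U ⟨τ (ι g) x, hρ₀G g x x.2⟩ : H) = τ (ι g) (U x) :=
      fun W hW hne => exists_equivariant_isometry_onto_slice hτ ι E hET W (slice W)
        (hslice_mem W) (hslice_G W) (hslice_irr W hW) ρ₀ hρ₀c hρ₀E hρ₀G hρ₀irr hne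
    -- some `W₀` with non-zero projection
    obtain ⟨W₀, hW₀, hne₀⟩ : ∃ W₀ ∈ S, ∃ x ∈ ρ₀, W₀.toSubmodule.starProjection x ≠ 0 := by
      by_contra hall
      push Not at hall
      apply hρ₀0
      rw [eq_bot_iff]
      intro x hx
      rw [Submodule.mem_bot]
      exact hL_dec x (hρ₀L x hx) fun W hW => hall W hW x hx
    obtain ⟨U₀, hU₀n, hU₀s, hU₀G⟩ := hU W₀ hW₀ hne₀
    -- every other member is projected onto trivially
    have huniq : ∀ W ∈ S, W ≠ W₀ → ∀ x ∈ ρ₀, W.toSubmodule.starProjection x = 0 := by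
      intro W hW hWW₀ x hx
      by_contra hPx
      obtain ⟨U₁, hU₁n, hU₁s, hU₁G⟩ := hU W hW ⟨x, hx, hPx⟩
      -- `slice W₀ ≅ ρ₀ ≅ slice W`
      have hslice₀0 : slice W₀ ≠ ⊥ := by
        obtain ⟨y, hy, hy0⟩ := (Submodule.ne_bot_iff ρ₀).1 hρ₀0
        refine (Submodule.ne_bot_iff _).2 ⟨U₀ ⟨y, hy⟩, (U₀ ⟨y, hy⟩).2, fun h0 => hy0 ?_⟩
        have h1 : ‖U₀ ⟨y, hy⟩‖ = 0 := by rw [← Submodule.norm_coe, h0, norm_zero]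
        rw [hU₀n, norm_eq_zero] at h1
        exact congrArg Subtype.val h1
      let U₀L : ρ₀ →ₗᵢ[ℂ] slice W₀ := { toLinearMap := U₀, norm_map' := hU₀n }
      let U₀E : ρ₀ ≃ₗᵢ[ℂ] slice W₀ := LinearIsometryEquiv.ofSurjective U₀L hU₀s
      have hU₀E : ∀ x, U₀E x = U₀ x := fun x => rfl
      let C : slice W₀ →L[ℂ] slice W :=
        U₁ ∘L (U₀E.symm.toContinuousLinearEquiv : slice W₀ →L[ℂ] ρ₀)
      have hC : ∀ y, C y = U₁ (U₀E.symm y) := fun y => rfl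
      have hCn : ∀ y, ‖C y‖ = ‖y‖ := fun y => by
        rw [hC, hU₁n, LinearIsometryEquiv.norm_map]
      have hCs : Function.Surjective C := fun z => by
        obtain ⟨x, rfl⟩ := hU₁s z
        exact ⟨U₀E x, by rw [hC, LinearIsometryEquiv.symm_apply_apply]⟩
      have hCG : ∀ (g : 𝔊) (y : slice W₀),
          (C ⟨τ (ι g) y, hslice_G W₀ g y y.2⟩ : H) = τ (ι g) (C y) := by
        intro g y
        set x : ρ₀ := U₀E.symm y with hxdef
        have hyx : U₀ x = y := by rw [← hU₀E, hxdef, LinearIsometryEquiv.apply_symm_apply]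
        have h1 : (⟨τ (ι g) (y : H), hslice_G W₀ g y y.2⟩ : slice W₀) =
            U₀ ⟨τ (ι g) (x : H), hρ₀G g x x.2⟩ := by
          apply Subtype.ext
          change τ (ι g) (y : H) = (U₀ ⟨τ (ι g) (x : H), hρ₀G g x x.2⟩ : H)
          rw [hU₀G g x, hyx]
        have h2 : U₀E.symm ⟨τ (ι g) (y : H), hslice_G W₀ g y y.2⟩ =
            ⟨τ (ι g) (x : H), hρ₀G g x x.2⟩ := by
          rw [h1, ← hU₀E, LinearIsometryEquiv.symm_apply_apply]
        rw [hC, h2, hU₁G g x, hC]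
      exact hWW₀ (hsep W₀ hW₀ W hW (slice W₀) (slice W) (hslice_mem W₀) (hslice_mem W)
        hslice₀0 (hslice_G W₀) ⟨C, hCn, hCs, hCG⟩).symm
    -- hence `ρ₀ ≤ W₀`
    have hρ₀W₀ : ∀ x ∈ ρ₀, x ∈ W₀ := by
      intro x hx
      have hPx : W₀.toSubmodule.starProjection x ∈ W₀ := W₀.toSubmodule.starProjection_apply_mem x
      set z : H := x - W₀.toSubmodule.starProjection x with hz
      have hzL : z ∈ L := L.toSubmodule.sub_mem (hρ₀L x hx) (hSL W₀ hW₀ hPx)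
      have hz0 : z = 0 := by
        refine hL_dec z hzL fun W hW => ?_
        by_cases hWW₀ : W = W₀
        · subst hWW₀
          rw [hz, map_sub, Submodule.starProjection_eq_self_iff.2 hPx, sub_self]
        · rw [hz, map_sub, huniq W hW hWW₀ x hx, zero_sub, neg_eq_zero,
            Submodule.starProjection_apply_eq_zero_iff]
          exact (hSorth hW₀ hW (Ne.symm hWW₀)).le hPx
      have : x = W₀.toSubmodule.starProjection x := sub_eq_zero.1 (by rw [← hz, hz0])
      rw [this]
      exact hPx
    -- and `ρ₀` is the slice of `W₀`
    refine ⟨W₀, hW₀, ?_⟩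
    have hle : ρ₀ ≤ slice W₀ := fun x hx => ⟨hρ₀W₀ x hx, hρ₀E x hx⟩
    rcases hslice_irr W₀ hW₀ ρ₀ hρ₀c hle hρ₀G with h | h
    · exact absurd h hρ₀0
    · intro x
      rw [h]
      exact hslice_mem W₀ x
  -- Step 2: apply to `ρ` and `ρ'`
  obtain ⟨U, hUn, hUs, hUG⟩ := hequiv
  have hρ'0 : ρ' ≠ ⊥ := by
    obtain ⟨y₀, hy₀, hy₀0⟩ := (Submodule.ne_bot_iff ρ).1 hρ0
    refine (Submodule.ne_bot_iff ρ').2 ⟨U ⟨y₀, hy₀⟩, (U ⟨y₀, hy₀⟩).2, fun h0 => hy₀0 ?_⟩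
    have h1 : ‖U ⟨y₀, hy₀⟩‖ = 0 := by
      rw [← Submodule.norm_coe, h0, norm_zero]
    rw [hUn, norm_eq_zero] at h1
    exact congrArg Subtype.val h1
  obtain ⟨W₀, hW₀, hρW₀⟩ := step ρ hρc hρM hρG hirr hρ0
  obtain ⟨W₀', hW₀', hρ'W₀'⟩ := step ρ' hρ'c hρ'M hρ'G hirr' hρ'0
  have hEq : W₀ = W₀' :=
    hsep W₀ hW₀ W₀' hW₀' ρ ρ' hρW₀ hρ'W₀' hρ0 hρG ⟨U, hUn, hUs, hUG⟩
  ext x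
  rw [hρW₀, hρ'W₀', hEq]

end SliceDecomposition

end ContRepresentation
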